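import Literature.MathematicalPhysics.QuantumFieldTheory.Balaban1983to89.B9Thm31SiteGsqHessianDecayReg335Y
import Literature.MathematicalPhysics.QuantumFieldTheory.Balaban1983to89.B9Thm31SiteGpDivDecayReg335Y

/-!
# `Balaban1983to89.B9Thm31SiteGsqSecondDecayReg335Y` — T. Bałaban, *Propagators for lattice gauge theories in a background field*, Commun. Math. Phys. **99** (1985)
# 389–434 [Balaban1985BackgroundPropagators] (3.46) p. 398 (fourth member `|(G′(U)D*_UD*_Uλ)(x)| ≤ B₀e^{−δ₀d(y,y′)}|λ|`), Cor 3.6 p. 408 («constants independent of □»),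
# (3.88) p. 409, (3.8) p. 392; [B6] = [Balaban1984PropagatorsII] (2.46) p. 231: ★★★ **THE SECOND-ORDER MEMBER `M_hG′_□(U)M_h∇\*_ν∇\*_μ` IN `L²`, BLOCK `s` TO BLOCK `t`,
# WITH PRINT'S DECAY AND A CONSTANT FREE OF `M`** — the 𝔸-level shape of dag-n06-k's `L2SecondLegs37.l5` ∕ the hypothesis `hHS` of dag-n06-w7's
# `B9Eq346SecondLegAtPinsL2.l2SecondLegs37_memberY_of_hs`, modulo the plaquette window (file 32 of width seat `pub-ymgap-dag-n06-w1`'s set; closes route (β′))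

statement-level skeleton of published theorems with citation tags; proofs where landed; nothing here is a claim about the Yang–Mills mass gap

THE PRINT ∕ WHY.  (3.46)'s fourth member decays block to block with `B₀` free of `Lʲη` and of `M`; Cor 3.6 gives the same for every local inverse `G′_□` («constants independent
of □»); the Theorem-3.7 walk (3.88) consumes it between the cut-offs `h_□` (dag-n06-k's `L2SecondLegs37.l5`, member-UNIFORM `B₃` — dag-n06-w7's shape note: `M_h` is unbounded
over the family, so file 28's global bound `C_H` alone does not close it).  THIS FILE assembles: NEAR pairs `d(t,s) ≤ r₀` by file 28's global `C_H`; FAR pairs by file 31's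
`hessian_block_far_le` at dag-n06-h's block bump `χ_s` (file 30; its block-scale sizes `2L^{−lev s}`, `2L^{−2 lev s}` are replaced by the `s`-free `2L²L^{−j′_D}`, `2L⁴L^{−2j′_D}`
using `lev s ≥ j′_D − 2`, the other case having a vanishing Hessian on `Δ(s)`); then g2's duality of support-restricted bounds `B9Thm31SiteGpDivDecayReg335Y.hs_restrict_dual_le`
(`‖1_t T₀∇*_ν∇*_μ 1_s‖ = ‖1_s ∇_μ∇_ν T₀ 1_t‖`, `T₀ = M_hG′_□M_h` trace-symmetric, (3.8) twice).

WHAT IS PROVED (sorry-free; 0 `def`; `r₀ = (d+1)(4(ℓ+1)+1)`, `m = r₀ + 3`, `δ₀ = 1∕(4(d+2))`; hypotheses EXACTLY file 28's: the (3.35) class with `G ≤ U(N)`, `N ≥ 1`,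
`0 ≤ cMα₀`, `cMα₀(d+1) ≤ 1∕16`; any `D`; real `h` on `D` with `|h| ≤ 1`, `|∂h| ≤ κ`, `|∂∂h| ≤ κ₂`, block oscillation `≤ κ_b`; levels in `[j′_D, j_D]` on `D`; pointwise
plaquette window `0 ≤ ε ≤ ε_D` within two forward steps of `D`).
* §1 `trIP_cdS_cdS_sandwich_adjoint` (`⟨∇_μ∇_νT₀Ψ, λ⟩ = ⟨Ψ, T₀∇*_ν∇*_μλ⟩`), `cdS_cdS_apply_eq_zero_of_lev` (the Hessian of a field on `D` vanishes on blocks of level `< j′_D − 2`);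
* §2 ★★ `hessian_block_le`: for ALL blocks `s t` and `Φ` on `Δ(t)`, `Σ_{z∈Δ(s)}Σ_{μν}HS((∇_μ∇_νM_hG′_□M_hΦ)(z)) ≤ C₃∕(e^{δ₀((d(t,s)−m)∕(2L)−1)})²·‖Φ‖²`,
  `C₃ = C_H + C_far` explicit in `κ, κ₂, κ_b, ε_D, L^{j_D}, L^{−j′_D}, L` — NO power of `M`;
* §3 ★★★ `hs_block_sandwich_cdsS_cdsS_le`: for ALL `ν μ s t` and `λ` on `Δ(s)`, `Σ_{z∈Δ(t)}HS((M_hG′_□M_h∇*_ν∇*_μλ)(z)) ≤ C₃∕(e^{δ₀((d(t,s)−m)∕(2L)−1)})²·‖λ‖²₁` — dag-n06-w7's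
  `hHS` verbatim at general `h`, `D` (at `h = hTY c`, `D = □̃(c)`: `κ = C₁∕(8∕5·S_j)`, `κ₂ = C₂∕(8∕5·S_j)²`, `κ_b = sLip∕(LM_h)` by file 25 §R1, `j_D = j(c)+1`, `j′_D = j(c)−1`
  by the window of `□̃`, so every product in `C₃` is member-uniform — the consumer's three lines, together with the plaquette window `ε` from (3.35)).
NOT HERE: the window `ε ≤ ε_D` near `□̃(c)` from `Reg335` (needs a class cube containing the three corners of each plaquette near `□̃(c)` — `B9Eq335PlaquetteAtLettersY.
norm_holY_sub_one_le_of_reg335` + file 26's `norm_plaqU_sub_one_le_of_holY`; the consumer's instantiation); `FactorsL2Second37.facDD`.  NON-VACUITY (A6): `U = 1`, `ε = 0`,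
`h = 0`.  HONEST SCOPE: one composition of landed `L²` estimates; NOT a node discharge, NOT summit progress; count-neutral; nothing continuum ∕ OS ∕ mass gap ∕ Clay; the YM
mass gap (Clay) is NOT proved by any of this — R4 closes the conditional finite-𝕋⁴ rung `BalabanLadder.UV` only.  NEW file importing files 31 and g2's file 14.  Net new
unproved facts: 0.
-/

noncomputable section

namespace Literature.MathematicalPhysics.QuantumFieldTheory.Balaban1983to89.B9Thm31SiteGsqSecondDecayReg335Y

open Literature.MathematicalPhysics.QuantumFieldTheory.Balaban1983to89
open Node00 B6KLevelCensusIndexV1 B6MultiLevelTorusOperator B6GlobalChartV1 B9BackgroundsKLevelV1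
  B9Eq39Adjoint B9Thm311ReadingCoords B9Thm311DeltaPrimePos B9Ineq369CurvatureSmallAtLettersY B9Thm31SiteCoerciveGaugeBlockY B9Thm31SiteGpBoundsReg335Y
  B9Thm31SiteCurvatureCommutatorsY B9Thm31SiteBochnerY B9Thm31SiteGsqHessianReg335Y B9Thm31SiteBlockBumpY B9Thm31SiteGsqHessianDecayReg335Y
open Literature.MathematicalPhysics.QuantumFieldTheory.Balaban1983to89.B9Ineq349SiteAdjoint (trIP_comm trIP_cdS_left)
open Literature.MathematicalPhysics.QuantumFieldTheory.Balaban1983to89.B9Thm37CubeCoverCommutators (cutMulY cutMulY_apply KhY)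
open Literature.MathematicalPhysics.QuantumFieldTheory.Balaban1983to89.B9Ineq346SecondOrderTorusCutoff (cutoffT)
open Literature.MathematicalPhysics.QuantumFieldTheory.Balaban1983to89.B9Thm31SiteGpDivDecayReg335Y (hs_restrict_dual_le)
open B6Geom246MultiLevelBox B6Geom246MultiLevelTorus B9Thm31SiteGsqDecayReg335Y B9Thm31SiteGsqBlockDistReg335Y Node00.OpsYLocalInverse
open scoped Matrix Matrix.Norms.L2Operator

variable {d ℓ : ℕ} {hd : 1 ≤ d + 1} {hL : Odd (ℓ + 1) ∧ 1 < ℓ + 1} {b₀ b₁ : ℝ}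
variable (i : KIdx d ℓ hd hL b₀ b₁) {N : ℕ} {G : Subgroup (Matrix (Fin N) (Fin N) ℂ)ˣ}

/-! ## §1 Adjointness of the Hessian of the sandwich; vanishing of the Hessian far below the level window -/

section Adjoint

/-- `⟨∇_μ∇_ν(M_hG′_□M_hΨ), λ⟩ = ⟨Ψ, M_hG′_□M_h(∇\*_ν∇\*_μλ)⟩` — (3.8) twice and the trace-symmetry of the sandwich (file 28).
[cite: Balaban1985BackgroundPropagators, (3.8) p.392, Thm 3.11 p.416 («symmetric»), (3.88) p.409] -/
theorem trIP_cdS_cdS_sandwich_adjoint (hG : G ≤ B7Prop2Explicit.unitaryUnits (Matrix (Fin N) (Fin N) ℂ)) {U : CfgY (Matrix (Fin N) (Fin N) ℂ) i}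
    (hU : ∀ μ x, U μ x ∈ G) (D : Finset (SiteY i)) (h : SiteY i → ℝ) (μ ν : Fin (d + 1)) (Ψ Λ : SiteY i → Matrix (Fin N) (Fin N) ℂ) :
    trIP (fun _ => (1 : ℝ)) (cdS i U μ (cdS i U ν (cutMulY h (GsqY i (parSymY i) D U (cutMulY h Ψ))))) Λ
      = trIP (fun _ => (1 : ℝ)) Ψ (cutMulY h (GsqY i (parSymY i) D U (cutMulY h (cdsS i U ν (cdsS i U μ Λ))))) := by
  have hUu : ∀ μ x, (U μ x : Matrix (Fin N) (Fin N) ℂ) ∈ unitary (Matrix (Fin N) (Fin N) ℂ) := fun μ x => hG (hU μ x)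
  rw [trIP_cdS_left i hUu, trIP_cdS_left i hUu, trIP_sandwich_symm i hG hU D h]

/-- the Hessian of a field `w` living on `D` (levels `≥ j′_D`) vanishes on every block of level `< j′_D − 2` (two lattice steps change the level by at most two).
[cite: Balaban1984PropagatorsII, (2.2) p.224; Balaban1985BackgroundPropagators, (3.3) p.390, bookkeeping] -/
theorem cdS_cdS_apply_eq_zero_of_lev {𝔸 : Type} [NormedRing 𝔸] [NormedAlgebra ℂ 𝔸] [CompleteSpace 𝔸] (U : CfgY 𝔸 i) {D : Finset (SiteY i)}
    {w : SiteY i → 𝔸} (hwD : ∀ z, z ∉ D → w z = 0) {jD' : ℕ} (hjD' : ∀ z ∈ D, jD' ≤ (blkOf i.D.toDomains z).1.1) (μ ν : Fin (d + 1))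
    {z : SiteY i} (hz : (blkOf i.D.toDomains z).1.1 + 2 < jD') : cdS i U μ (cdS i U ν w) z = 0 := by
  have hout : ∀ y : SiteY i, (blkOf i.D.toDomains y).1.1 < jD' → w y = 0 := fun y hy => hwD y fun hyD => absurd (hjD' y hyD) (not_le.2 hy)
  have h1 := lev_shiftY_le i μ z
  have h2 := lev_shiftY_le i ν z
  have h3 := lev_shiftY_le i ν (shiftY i μ z)
  show R (UboxY i U μ z) (R (UboxY i U ν (shiftY i μ z)) (w (shiftY i ν (shiftY i μ z))) - w (shiftY i μ z)) - (R (UboxY i U ν z) (w (shiftY i ν z)) - w z) = 0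
  rw [hout _ (by omega), hout _ (by omega), hout _ (by omega), hout z (by omega)]
  simp only [R_zero, sub_zero]

end Adjoint

/-! ## §2 The Hessian of the sandwich on `Δ(s)` for a source on `Δ(t)`: all pairs -/

section AllPairs

variable [Nonempty (Fin N)] {c α₀ : ℝ}

/-- kernel bookkeeping, near pairs: `A ≤ C_N‖Φ‖²` and `E_t ≤ 1` give `A ≤ (C_N + C_F)∕E_t²·‖Φ‖²`. [folklore] -/
private theorem le_kernel_of_near {A Q CN CF Et : ℝ} (hA : A ≤ CN * Q) (hEt1 : Et ≤ 1) (hEt0 : 0 < Et) (hCN : 0 ≤ CN) (hCF : 0 ≤ CF)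
    (hQ : 0 ≤ Q) : A ≤ (CN + CF) / Et ^ 2 * Q := by
  refine hA.trans (mul_le_mul_of_nonneg_right ?_ hQ)
  rw [le_div_iff₀ (pow_pos hEt0 2)]
  have hE2 : Et ^ 2 ≤ 1 := by nlinarith
  nlinarith

/-- kernel bookkeeping, far pairs: `A ≤ C_F∕E_f²·‖Φ‖²` and `E_t ≤ E_f` give `A ≤ (C_N + C_F)∕E_t²·‖Φ‖²`. [folklore] -/
private theorem le_kernel_of_far {A Q CN CF Et Ef : ℝ} (hA : A ≤ CF / Ef ^ 2 * Q) (hE : Et ≤ Ef) (hEt0 : 0 < Et) (hCN : 0 ≤ CN) (hCF : 0 ≤ CF)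
    (hQ : 0 ≤ Q) : A ≤ (CN + CF) / Et ^ 2 * Q := by
  refine hA.trans (mul_le_mul_of_nonneg_right ?_ hQ)
  have h1 : CF / Ef ^ 2 ≤ CF / Et ^ 2 := div_le_div_of_nonneg_left hCF (pow_pos hEt0 2) (pow_le_pow_left₀ hEt0.le hE 2)
  exact h1.trans (div_le_div_of_nonneg_right (by linarith) (pow_nonneg hEt0.le 2))

set_option maxHeartbeats 400000 in
/-- ★★ **THE HESSIAN OF `M_hG′_□(U)M_h` ON `Δ(s)` FOR A SOURCE ON `Δ(t)`, ALL PAIRS, PRINT'S DECAY, CONSTANT FREE OF `M`**: under file 28's hypotheses, for all blocks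
`s t` and `Φ` carried by `Δ(t)`, `Σ_{z∈Δ(s)}Σ_{μν}HS((∇_μ∇_νM_hG′_□M_hΦ)(z)) ≤ (C_H + C_far)∕(e^{δ₀((d(t,s)−m)∕(2L)−1)})²·‖Φ‖²`, `m = r₀ + 3`: near pairs by file 28
(`C_H`), far pairs by file 31 at dag-n06-h's bump `χ_s` with the `s`-free sizes `κ_χ = 2L²L^{−j′_D}`, `κ_χ₂ = 2L⁴L^{−2j′_D}`, `κ_χb = 1` (valid when `lev s + 2 ≥ j′_D`;
otherwise the Hessian vanishes on `Δ(s)`). [cite: Balaban1985BackgroundPropagators, (3.46) p.398 (sixth member), Cor 3.6 p.408, (3.88) p.409; Balaban1984PropagatorsII, (2.46) p.231, p.247; Agmon1982, Ch.1, Thm 1.5] -/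
theorem hessian_block_le (hG : G ≤ B7Prop2Explicit.unitaryUnits (Matrix (Fin N) (Fin N) ℂ)) {U : CfgY (Matrix (Fin N) (Fin N) ℂ) i}
    (hC0 : 0 ≤ c * (kGeo i).M * α₀) (hC1 : c * (kGeo i).M * α₀ * ((d : ℝ) + 1) ≤ 1 / 16) (hreg : (bg9K (Matrix (Fin N) (Fin N) ℂ) G i).Reg335 c α₀ U)
    (D : Finset (SiteY i)) {h : SiteY i → ℝ} {κ κ₂ κb : ℝ} (hh1 : ∀ z, |h z| ≤ 1) (hhκ : ∀ μ z, |h (shiftY i μ z) - h z| ≤ κ)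
    (hhκ₂ : ∀ μ z, |h (shiftY i μ z) + h ((shiftY i μ).symm z) - 2 * h z| ≤ κ₂)
    (hhb : ∀ z w : SiteY i, blkOf i.D.toDomains w = blkOf i.D.toDomains z → |h z - h w| ≤ κb) (hhD : ∀ z, z ∉ D → h z = 0)
    {jD jD' : ℕ} (hjD : ∀ z ∈ D, (blkOf i.D.toDomains z).1.1 ≤ jD) (hjD' : ∀ z ∈ D, jD' ≤ (blkOf i.D.toDomains z).1.1)
    {ε : SiteY i → ℝ} {εD : ℝ} (hε0 : ∀ z, 0 ≤ ε z) (hεD0 : 0 ≤ εD)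
    (hF : ∀ μ ν z, ‖((plaqU (shiftY i) (UboxY i U) μ ν z : (Matrix (Fin N) (Fin N) ℂ)ˣ) : Matrix (Fin N) (Fin N) ℂ) - 1‖ ≤ ε z)
    (hεD : ∀ x μ ν, shiftY i ν (shiftY i μ x) ∈ D → ε x ≤ εD) (hεD' : ∀ x μ, shiftY i μ x ∈ D → ε x ≤ εD)
    (s t : BlkY i) {Φ : SiteY i → Matrix (Fin N) (Fin N) ℂ} (hΦ : ∀ z, blkOf i.D.toDomains z ≠ t → Φ z = 0) :
    ∑ z ∈ Finset.univ.filter (fun z : SiteY i => blkOf i.D.toDomains z = s), ∑ μ : Fin (d + 1), ∑ ν : Fin (d + 1), ∑ a, ∑ b,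
        ‖cdS i U μ (cdS i U ν (cutMulY h (GsqY i (parSymY i) D U (cutMulY h Φ)))) z a b‖ ^ 2
      ≤ (4 / 3 * (4 + 4 * (2560 * ((d : ℝ) + 1) * κ ^ 2 * ((((ℓ + 1) ^ jD : ℕ) : ℝ)) ^ 2
              + 1024 * (((d : ℝ) + 1) * κ₂) ^ 2 * (((((ℓ + 1) ^ jD : ℕ) : ℝ)) ^ 2) ^ 2
              + 512 * κb ^ 2 * ((((((ℓ + 1) ^ jD' : ℕ) : ℝ)) ^ 2)⁻¹) ^ 2 * (((((ℓ + 1) ^ jD : ℕ) : ℝ)) ^ 2) ^ 2)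
            + 512 * ((((((ℓ + 1) ^ jD' : ℕ) : ℝ)) ^ 2)⁻¹) ^ 2 * (((((ℓ + 1) ^ jD : ℕ) : ℝ)) ^ 2) ^ 2
            + 1024 * ((d : ℝ) + 1) ^ 2 * εD ^ 2 * (((((ℓ + 1) ^ jD : ℕ) : ℝ)) ^ 2) ^ 2
            + 2 * ((d : ℝ) + 1) * εD * (320 * ((((ℓ + 1) ^ jD : ℕ) : ℝ)) ^ 2 + 512 * ((d : ℝ) + 1) * κ ^ 2 * (((((ℓ + 1) ^ jD : ℕ) : ℝ)) ^ 2) ^ 2))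
          + 4 / 3 * (4 * (8 * ((d : ℝ) + 1) * κ ^ 2 * (2 * (160 * ((((ℓ + 1) ^ jD : ℕ) : ℝ)) ^ 2)) + 4 * (((d : ℝ) + 1) * κ₂) ^ 2 * (256 * (((((ℓ + 1) ^ jD : ℕ) : ℝ)) ^ 2 * ((((ℓ + 1) ^ jD : ℕ) : ℝ)) ^ 2)) + 2 * κb ^ 2 * ((((((ℓ + 1) ^ jD' : ℕ) : ℝ)) ^ 2)⁻¹ ^ 2 * (256 * (((((ℓ + 1) ^ jD : ℕ) : ℝ)) ^ 2 * ((((ℓ + 1) ^ jD : ℕ) : ℝ)) ^ 2))))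
        + 4 * (8 * ((d : ℝ) + 1) * (2 * (((ℓ + 1 : ℕ) : ℝ)) ^ 2 * ((((ℓ + 1) ^ jD' : ℕ) : ℝ))⁻¹) ^ 2 * (2 * (2 * (160 * ((((ℓ + 1) ^ jD : ℕ) : ℝ)) ^ 2) + 2 * ((d : ℝ) + 1) * κ ^ 2 * (256 * (((((ℓ + 1) ^ jD : ℕ) : ℝ)) ^ 2 * ((((ℓ + 1) ^ jD : ℕ) : ℝ)) ^ 2)))) + 4 * (((d : ℝ) + 1) * (2 * (((ℓ + 1 : ℕ) : ℝ)) ^ 4 * (((((ℓ + 1) ^ jD' : ℕ) : ℝ)) ^ 2)⁻¹)) ^ 2 * (256 * (((((ℓ + 1) ^ jD : ℕ) : ℝ)) ^ 2 * ((((ℓ + 1) ^ jD : ℕ) : ℝ)) ^ 2)) + 2 * (1 : ℝ) ^ 2 * ((((((ℓ + 1) ^ jD' : ℕ) : ℝ)) ^ 2)⁻¹ ^ 2 * (256 * (((((ℓ + 1) ^ jD : ℕ) : ℝ)) ^ 2 * ((((ℓ + 1) ^ jD : ℕ) : ℝ)) ^ 2))))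
        + 2 * ((((((ℓ + 1) ^ jD' : ℕ) : ℝ)) ^ 2)⁻¹ ^ 2 * (256 * (((((ℓ + 1) ^ jD : ℕ) : ℝ)) ^ 2 * ((((ℓ + 1) ^ jD : ℕ) : ℝ)) ^ 2)))
        + (((d : ℝ) + 1) ^ 2 * (4 * (εD ^ 2 * (256 * (((((ℓ + 1) ^ jD : ℕ) : ℝ)) ^ 2 * ((((ℓ + 1) ^ jD : ℕ) : ℝ)) ^ 2))))
          + 2 * ((d : ℝ) + 1) * εD * (2 * (2 * (160 * ((((ℓ + 1) ^ jD : ℕ) : ℝ)) ^ 2) + 2 * ((d : ℝ) + 1) * κ ^ 2 * (256 * (((((ℓ + 1) ^ jD : ℕ) : ℝ)) ^ 2 * ((((ℓ + 1) ^ jD : ℕ) : ℝ)) ^ 2))) + 2 * ((d : ℝ) + 1) * (2 * (((ℓ + 1 : ℕ) : ℝ)) ^ 2 * ((((ℓ + 1) ^ jD' : ℕ) : ℝ))⁻¹) ^ 2 * (256 * (((((ℓ + 1) ^ jD : ℕ) : ℝ)) ^ 2 * ((((ℓ + 1) ^ jD : ℕ) : ℝ)) ^ 2))))))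
          / Real.exp ((1 / (4 * ((d : ℝ) + 2))) * (((((bondT i.D).dist t s : ℕ) : ℝ) - (((((d + 1) * (4 * (ℓ + 1) + 1)) + 3 : ℕ)) : ℝ)) / (2 * ((ℓ + 1 : ℕ) : ℝ)) - 1)) ^ 2
        * trIP (fun _ => (1 : ℝ)) Φ Φ := by
  classical
  have hU : ∀ μ x, U μ x ∈ G := hreg.1
  have hQ0 : 0 ≤ trIP (fun _ => (1 : ℝ)) Φ Φ := trIP_self_nonneg _ (fun _ => one_pos) Φ
  have hκ0 : 0 ≤ κ := le_trans (abs_nonneg _) (hhκ 0 (Classical.arbitrary _))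
  have hL1 : (1 : ℝ) ≤ ((ℓ + 1 : ℕ) : ℝ) := by exact_mod_cast Nat.succ_le_succ (Nat.zero_le ℓ)
  have hL0 : (0 : ℝ) < 2 * ((ℓ + 1 : ℕ) : ℝ) := by positivity
  have hwD : ∀ z, z ∉ D → cutMulY h (GsqY i (parSymY i) D U (cutMulY h Φ)) z = 0 := fun z hz => by
    rw [cutMulY_apply, GsqY_apply_eq_zero i (parSymY i) U _ hz, smul_zero]
  by_cases hfar : (d + 1) * (4 * (ℓ + 1) + 1) + 1 ≤ (bondT i.D).dist t s
  · -- FAR pairs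
    by_cases hlev : jD' ≤ s.1.1 + 2
    · -- the bump `χ_s` with `s`-free sizes
      have hLs : ((((ℓ + 1) ^ jD' : ℕ) : ℝ)) ≤ (((ℓ + 1) ^ s.1.1 : ℕ) : ℝ) * (((ℓ + 1 : ℕ) : ℝ)) ^ 2 := by
        have h1 : (ℓ + 1) ^ jD' ≤ (ℓ + 1) ^ s.1.1 * (ℓ + 1) ^ 2 := by
          rw [← pow_add]; exact Nat.pow_le_pow_right (Nat.succ_pos ℓ) hlev
        exact_mod_cast h1
      have hLs0 : (0 : ℝ) < (((ℓ + 1) ^ s.1.1 : ℕ) : ℝ) := by positivity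
      have hLj0 : (0 : ℝ) < (((ℓ + 1) ^ jD' : ℕ) : ℝ) := by positivity
      have hinv : ((((ℓ + 1) ^ s.1.1 : ℕ) : ℝ))⁻¹ ≤ (((ℓ + 1 : ℕ) : ℝ)) ^ 2 * ((((ℓ + 1) ^ jD' : ℕ) : ℝ))⁻¹ := by
        rw [inv_eq_one_div, ← div_eq_mul_inv, div_le_div_iff₀ hLs0 hLj0, one_mul, mul_comm]
        exact hLs
      have hinv2 : (((((ℓ + 1) ^ s.1.1 : ℕ) : ℝ)) ^ 2)⁻¹ ≤ (((ℓ + 1 : ℕ) : ℝ)) ^ 4 * (((((ℓ + 1) ^ jD' : ℕ) : ℝ)) ^ 2)⁻¹ := by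
        have := mul_le_mul hinv hinv (by positivity) (by positivity)
        calc (((((ℓ + 1) ^ s.1.1 : ℕ) : ℝ)) ^ 2)⁻¹ = ((((ℓ + 1) ^ s.1.1 : ℕ) : ℝ))⁻¹ * ((((ℓ + 1) ^ s.1.1 : ℕ) : ℝ))⁻¹ := by rw [sq, mul_inv]
          _ ≤ _ := this
          _ = _ := by ring
      have hχκ : ∀ μ z, |cutoffT i.D s (shiftY i μ z) - cutoffT i.D s z| ≤ (2 * (((ℓ + 1 : ℕ) : ℝ)) ^ 2 * ((((ℓ + 1) ^ jD' : ℕ) : ℝ))⁻¹) := fun μ z =>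
        (abs_cutoffT_shiftY_sub_le i s μ z).trans (by linarith [hinv])
      have hχκ₂ : ∀ μ z, |cutoffT i.D s (shiftY i μ z) + cutoffT i.D s ((shiftY i μ).symm z) - 2 * cutoffT i.D s z| ≤ (2 * (((ℓ + 1 : ℕ) : ℝ)) ^ 4 * (((((ℓ + 1) ^ jD' : ℕ) : ℝ)) ^ 2)⁻¹) := fun μ z =>
        (abs_cutoffT_second_diff_le i s μ z).trans (by linarith [hinv2])
      have hfarB := hessian_block_far_le i hG hC0 hC1 hreg D hh1 hhκ hhκ₂ hhb hhD hjD hjD' hε0 hεD0 hF hεD hεD' s t (fun z : SiteY i => cutoffT i.D s z)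
        (κχb := (1 : ℝ)) (r := (d + 1) * (4 * (ℓ + 1) + 1)) (abs_cutoffT_le_one i s) hχκ hχκ₂ (fun z w _ => abs_cutoffT_sub_le_one i s z w)
        (cutoffT_support i s) (cutoffT_plateau' i s) hfar hΦ
      refine le_kernel_of_far hfarB ?_ (Real.exp_pos _) (by positivity) (by positivity) hQ0
      -- `E_target ≤ E_far`
      refine Real.exp_le_exp.2 (mul_le_mul_of_nonneg_left ?_ (by positivity))
      have hcast : ((((bondT i.D).dist t s : ℕ) : ℝ)) - (((((d + 1) * (4 * (ℓ + 1) + 1)) + 3 : ℕ)) : ℝ) ≤ ((((bondT i.D).dist t s - ((d + 1) * (4 * (ℓ + 1) + 1) + 2) : ℕ) : ℝ)) - 1 := by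
        have hn : (bondT i.D).dist t s + 1 ≤ (bondT i.D).dist t s - ((d + 1) * (4 * (ℓ + 1) + 1) + 2) + (((d + 1) * (4 * (ℓ + 1) + 1)) + 3) := by omega
        have hn' : ((((bondT i.D).dist t s : ℕ) : ℝ)) + 1
            ≤ ((((bondT i.D).dist t s - ((d + 1) * (4 * (ℓ + 1) + 1) + 2) : ℕ) : ℝ)) + (((((d + 1) * (4 * (ℓ + 1) + 1)) + 3 : ℕ)) : ℝ) := by
          exact_mod_cast hn
        linarith
      have := div_le_div_of_nonneg_right hcast hL0.le
      linarith
    · -- degenerate: the Hessian vanishes on `Δ(s)`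
      have h0 : ∑ z ∈ Finset.univ.filter (fun z : SiteY i => blkOf i.D.toDomains z = s), ∑ μ : Fin (d + 1), ∑ ν : Fin (d + 1), ∑ a, ∑ b,
          ‖cdS i U μ (cdS i U ν (cutMulY h (GsqY i (parSymY i) D U (cutMulY h Φ)))) z a b‖ ^ 2 = 0 := by
        refine Finset.sum_eq_zero fun z hz => ?_
        have hzs : blkOf i.D.toDomains z = s := (Finset.mem_filter.1 hz).2
        refine Finset.sum_eq_zero fun μ _ => Finset.sum_eq_zero fun ν _ => ?_
        rw [cdS_cdS_apply_eq_zero_of_lev i U hwD hjD' μ ν (by rw [hzs]; omega)]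
        simp
      rw [h0]
      positivity
  · -- NEAR pairs: the global bound of file 28, `E_target ≤ 1`
    have hglob := hessian_cutMulY_GsqY_cutMulY_le i hG hC0 hC1 hreg D hh1 hhκ hhκ₂ hhb hhD hjD hjD' hε0 hεD0 hF hεD hεD' Φ
    have hsub : ∑ z ∈ Finset.univ.filter (fun z : SiteY i => blkOf i.D.toDomains z = s), ∑ μ : Fin (d + 1), ∑ ν : Fin (d + 1), ∑ a, ∑ b,
          ‖cdS i U μ (cdS i U ν (cutMulY h (GsqY i (parSymY i) D U (cutMulY h Φ)))) z a b‖ ^ 2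
        ≤ ∑ μ : Fin (d + 1), ∑ ν : Fin (d + 1), trIP (fun _ => (1 : ℝ))
          (cdS i U μ (cdS i U ν (cutMulY h (GsqY i (parSymY i) D U (cutMulY h Φ)))))
          (cdS i U μ (cdS i U ν (cutMulY h (GsqY i (parSymY i) D U (cutMulY h Φ))))) := by
      calc ∑ z ∈ Finset.univ.filter (fun z : SiteY i => blkOf i.D.toDomains z = s), ∑ μ : Fin (d + 1), ∑ ν : Fin (d + 1), ∑ a, ∑ b,
            ‖cdS i U μ (cdS i U ν (cutMulY h (GsqY i (parSymY i) D U (cutMulY h Φ)))) z a b‖ ^ 2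
          ≤ ∑ z, ∑ μ : Fin (d + 1), ∑ ν : Fin (d + 1), ∑ a, ∑ b, ‖cdS i U μ (cdS i U ν (cutMulY h (GsqY i (parSymY i) D U (cutMulY h Φ)))) z a b‖ ^ 2 :=
            Finset.sum_le_sum_of_subset_of_nonneg (Finset.subset_univ _) fun _ _ _ =>
              Finset.sum_nonneg fun _ _ => Finset.sum_nonneg fun _ _ => hs_nonneg _
        _ = _ := by
            rw [Finset.sum_comm]
            refine Finset.sum_congr rfl fun μ _ => ?_
            rw [Finset.sum_comm]
            refine Finset.sum_congr rfl fun ν _ => ?_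
            rw [trIP_one_self_eq]
    refine le_kernel_of_near (hsub.trans hglob) ?_ (Real.exp_pos _) (by positivity) (by positivity) hQ0
    refine Real.exp_le_one_iff.2 (mul_nonpos_of_nonneg_of_nonpos (by positivity) ?_)
    have hd : ((((bondT i.D).dist t s : ℕ) : ℝ)) - ((((d + 1) * (4 * (ℓ + 1) + 1)) + 3 : ℕ) : ℝ) ≤ 0 := by
      have h1 : (bondT i.D).dist t s ≤ ((d + 1) * (4 * (ℓ + 1) + 1)) + 3 := by omega
      have h2 : ((((bondT i.D).dist t s : ℕ) : ℝ)) ≤ (((((d + 1) * (4 * (ℓ + 1) + 1)) + 3 : ℕ)) : ℝ) := by exact_mod_cast h1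
      linarith
    have := div_nonpos_of_nonpos_of_nonneg hd hL0.le
    linarith

end AllPairs

/-! ## §3 The second-order member `M_hG′_□M_h∇*_ν∇*_μ`, block `s` to block `t` — dag-n06-w7's `hHS` at general `h`, `D` -/

section Second

variable [Nonempty (Fin N)] {c α₀ : ℝ}

set_option maxHeartbeats 400000 in
/-- ★★★ **THE SECOND-ORDER MEMBER OF (3.46) FOR THE SANDWICHED LOCAL CUBE INVERSE, BLOCK `s` TO BLOCK `t`, WITH PRINT'S DECAY AND A CONSTANT FREE OF `M`** (the
𝔸-level shape of dag-n06-k's `L2SecondLegs37.l5` ∕ dag-n06-w7's hypothesis `hHS`): under file 28's hypotheses, for all directions `ν μ`, blocks `s t` and `λ` carried by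
`Δ(s)`: `Σ_{z∈Δ(t)} HS((M_hG′_□(U)M_h∇\*_ν∇\*_μλ)(z)) ≤ C₃ ∕ (e^{δ₀((d_T(t,s)−m)∕(2L)−1)})²·‖λ‖²₁`, `m = (d+1)(4L+1) + 3`, `C₃ = C_H + C_far` of `hessian_block_le`
(duality `hs_restrict_dual_le` over §1's adjointness). [cite: Balaban1985BackgroundPropagators, (3.46) p.398 (fourth member), Cor 3.6 p.408, (3.88) p.409, (3.8) p.392; Balaban1984PropagatorsII, (2.43) p.230, (2.46) p.231; Agmon1982, Ch.1, Thm 1.5] -/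
theorem hs_block_sandwich_cdsS_cdsS_le (hG : G ≤ B7Prop2Explicit.unitaryUnits (Matrix (Fin N) (Fin N) ℂ)) {U : CfgY (Matrix (Fin N) (Fin N) ℂ) i}
    (hC0 : 0 ≤ c * (kGeo i).M * α₀) (hC1 : c * (kGeo i).M * α₀ * ((d : ℝ) + 1) ≤ 1 / 16) (hreg : (bg9K (Matrix (Fin N) (Fin N) ℂ) G i).Reg335 c α₀ U)
    (D : Finset (SiteY i)) {h : SiteY i → ℝ} {κ κ₂ κb : ℝ} (hh1 : ∀ z, |h z| ≤ 1) (hhκ : ∀ μ z, |h (shiftY i μ z) - h z| ≤ κ)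
    (hhκ₂ : ∀ μ z, |h (shiftY i μ z) + h ((shiftY i μ).symm z) - 2 * h z| ≤ κ₂)
    (hhb : ∀ z w : SiteY i, blkOf i.D.toDomains w = blkOf i.D.toDomains z → |h z - h w| ≤ κb) (hhD : ∀ z, z ∉ D → h z = 0)
    {jD jD' : ℕ} (hjD : ∀ z ∈ D, (blkOf i.D.toDomains z).1.1 ≤ jD) (hjD' : ∀ z ∈ D, jD' ≤ (blkOf i.D.toDomains z).1.1)
    {ε : SiteY i → ℝ} {εD : ℝ} (hε0 : ∀ z, 0 ≤ ε z) (hεD0 : 0 ≤ εD)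
    (hF : ∀ μ ν z, ‖((plaqU (shiftY i) (UboxY i U) μ ν z : (Matrix (Fin N) (Fin N) ℂ)ˣ) : Matrix (Fin N) (Fin N) ℂ) - 1‖ ≤ ε z)
    (hεD : ∀ x μ ν, shiftY i ν (shiftY i μ x) ∈ D → ε x ≤ εD) (hεD' : ∀ x μ, shiftY i μ x ∈ D → ε x ≤ εD)
    (ν μ : Fin (d + 1)) (s t : BlkY i) {Λ : SiteY i → Matrix (Fin N) (Fin N) ℂ} (hΛ : ∀ z, blkOf i.D.toDomains z ≠ s → Λ z = 0) :
    ∑ z ∈ Finset.univ.filter (fun z : SiteY i => blkOf i.D.toDomains z = t), ∑ a, ∑ b,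
        ‖cutMulY h (GsqY i (parSymY i) D U (cutMulY h (cdsS i U ν (cdsS i U μ Λ)))) z a b‖ ^ 2
      ≤ (4 / 3 * (4 + 4 * (2560 * ((d : ℝ) + 1) * κ ^ 2 * ((((ℓ + 1) ^ jD : ℕ) : ℝ)) ^ 2
              + 1024 * (((d : ℝ) + 1) * κ₂) ^ 2 * (((((ℓ + 1) ^ jD : ℕ) : ℝ)) ^ 2) ^ 2
              + 512 * κb ^ 2 * ((((((ℓ + 1) ^ jD' : ℕ) : ℝ)) ^ 2)⁻¹) ^ 2 * (((((ℓ + 1) ^ jD : ℕ) : ℝ)) ^ 2) ^ 2)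
            + 512 * ((((((ℓ + 1) ^ jD' : ℕ) : ℝ)) ^ 2)⁻¹) ^ 2 * (((((ℓ + 1) ^ jD : ℕ) : ℝ)) ^ 2) ^ 2
            + 1024 * ((d : ℝ) + 1) ^ 2 * εD ^ 2 * (((((ℓ + 1) ^ jD : ℕ) : ℝ)) ^ 2) ^ 2
            + 2 * ((d : ℝ) + 1) * εD * (320 * ((((ℓ + 1) ^ jD : ℕ) : ℝ)) ^ 2 + 512 * ((d : ℝ) + 1) * κ ^ 2 * (((((ℓ + 1) ^ jD : ℕ) : ℝ)) ^ 2) ^ 2))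
          + 4 / 3 * (4 * (8 * ((d : ℝ) + 1) * κ ^ 2 * (2 * (160 * ((((ℓ + 1) ^ jD : ℕ) : ℝ)) ^ 2)) + 4 * (((d : ℝ) + 1) * κ₂) ^ 2 * (256 * (((((ℓ + 1) ^ jD : ℕ) : ℝ)) ^ 2 * ((((ℓ + 1) ^ jD : ℕ) : ℝ)) ^ 2)) + 2 * κb ^ 2 * ((((((ℓ + 1) ^ jD' : ℕ) : ℝ)) ^ 2)⁻¹ ^ 2 * (256 * (((((ℓ + 1) ^ jD : ℕ) : ℝ)) ^ 2 * ((((ℓ + 1) ^ jD : ℕ) : ℝ)) ^ 2))))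
        + 4 * (8 * ((d : ℝ) + 1) * (2 * (((ℓ + 1 : ℕ) : ℝ)) ^ 2 * ((((ℓ + 1) ^ jD' : ℕ) : ℝ))⁻¹) ^ 2 * (2 * (2 * (160 * ((((ℓ + 1) ^ jD : ℕ) : ℝ)) ^ 2) + 2 * ((d : ℝ) + 1) * κ ^ 2 * (256 * (((((ℓ + 1) ^ jD : ℕ) : ℝ)) ^ 2 * ((((ℓ + 1) ^ jD : ℕ) : ℝ)) ^ 2)))) + 4 * (((d : ℝ) + 1) * (2 * (((ℓ + 1 : ℕ) : ℝ)) ^ 4 * (((((ℓ + 1) ^ jD' : ℕ) : ℝ)) ^ 2)⁻¹)) ^ 2 * (256 * (((((ℓ + 1) ^ jD : ℕ) : ℝ)) ^ 2 * ((((ℓ + 1) ^ jD : ℕ) : ℝ)) ^ 2)) + 2 * (1 : ℝ) ^ 2 * ((((((ℓ + 1) ^ jD' : ℕ) : ℝ)) ^ 2)⁻¹ ^ 2 * (256 * (((((ℓ + 1) ^ jD : ℕ) : ℝ)) ^ 2 * ((((ℓ + 1) ^ jD : ℕ) : ℝ)) ^ 2))))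
        + 2 * ((((((ℓ + 1) ^ jD' : ℕ) : ℝ)) ^ 2)⁻¹ ^ 2 * (256 * (((((ℓ + 1) ^ jD : ℕ) : ℝ)) ^ 2 * ((((ℓ + 1) ^ jD : ℕ) : ℝ)) ^ 2)))
        + (((d : ℝ) + 1) ^ 2 * (4 * (εD ^ 2 * (256 * (((((ℓ + 1) ^ jD : ℕ) : ℝ)) ^ 2 * ((((ℓ + 1) ^ jD : ℕ) : ℝ)) ^ 2))))
          + 2 * ((d : ℝ) + 1) * εD * (2 * (2 * (160 * ((((ℓ + 1) ^ jD : ℕ) : ℝ)) ^ 2) + 2 * ((d : ℝ) + 1) * κ ^ 2 * (256 * (((((ℓ + 1) ^ jD : ℕ) : ℝ)) ^ 2 * ((((ℓ + 1) ^ jD : ℕ) : ℝ)) ^ 2))) + 2 * ((d : ℝ) + 1) * (2 * (((ℓ + 1 : ℕ) : ℝ)) ^ 2 * ((((ℓ + 1) ^ jD' : ℕ) : ℝ))⁻¹) ^ 2 * (256 * (((((ℓ + 1) ^ jD : ℕ) : ℝ)) ^ 2 * ((((ℓ + 1) ^ jD : ℕ) : ℝ)) ^ 2))))))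
          / Real.exp ((1 / (4 * ((d : ℝ) + 2))) * (((((bondT i.D).dist t s : ℕ) : ℝ) - (((((d + 1) * (4 * (ℓ + 1) + 1)) + 3 : ℕ)) : ℝ)) / (2 * ((ℓ + 1 : ℕ) : ℝ)) - 1)) ^ 2
        * trIP (fun _ => (1 : ℝ)) Λ Λ := by
  classical
  have hU : ∀ μ x, U μ x ∈ G := hreg.1
  have hκ0 : 0 ≤ κ := le_trans (abs_nonneg _) (hhκ 0 (Classical.arbitrary _))
  refine hs_restrict_dual_le (T := fun Ψ => cdS i U μ (cdS i U ν (cutMulY h (GsqY i (parSymY i) D U (cutMulY h Ψ)))))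
    (T' := fun Λ' => cutMulY h (GsqY i (parSymY i) D U (cutMulY h (cdsS i U ν (cdsS i U μ Λ')))))
    (fun Ψ Λ' => trIP_cdS_cdS_sandwich_adjoint i hG hU D h μ ν Ψ Λ')
    (A := Finset.univ.filter (fun z : SiteY i => blkOf i.D.toDomains z = s)) (B := Finset.univ.filter (fun z : SiteY i => blkOf i.D.toDomains z = t))
    (by positivity) (fun Ψ hΨ => ?_) Λ (fun z hz => hΛ z fun e => hz (Finset.mem_filter.2 ⟨Finset.mem_univ _, e⟩))
  -- one pair `(μ, ν)` of the double sum bounded in §2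
  have hΨt : ∀ z, blkOf i.D.toDomains z ≠ t → Ψ z = 0 := fun z hz => hΨ z fun hz' => hz (Finset.mem_filter.1 hz').2
  refine le_trans ?_ (hessian_block_le i hG hC0 hC1 hreg D hh1 hhκ hhκ₂ hhb hhD hjD hjD' hε0 hεD0 hF hεD hεD' s t hΨt)
  have hnn : ∀ z (μ' ν' : Fin (d + 1)), 0 ≤ ∑ a, ∑ b, ‖cdS i U μ' (cdS i U ν' (cutMulY h (GsqY i (parSymY i) D U (cutMulY h Ψ)))) z a b‖ ^ 2 := fun _ _ _ => hs_nonneg _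
  refine Finset.sum_le_sum fun z _ => ?_
  calc ∑ a, ∑ b, ‖cdS i U μ (cdS i U ν (cutMulY h (GsqY i (parSymY i) D U (cutMulY h Ψ)))) z a b‖ ^ 2
      ≤ ∑ ν' : Fin (d + 1), ∑ a, ∑ b, ‖cdS i U μ (cdS i U ν' (cutMulY h (GsqY i (parSymY i) D U (cutMulY h Ψ)))) z a b‖ ^ 2 :=
        Finset.single_le_sum (f := fun ν' => ∑ a, ∑ b, ‖cdS i U μ (cdS i U ν' (cutMulY h (GsqY i (parSymY i) D U (cutMulY h Ψ)))) z a b‖ ^ 2)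
          (fun ν' _ => hnn z μ ν') (Finset.mem_univ ν)
    _ ≤ ∑ μ' : Fin (d + 1), ∑ ν' : Fin (d + 1), ∑ a, ∑ b, ‖cdS i U μ' (cdS i U ν' (cutMulY h (GsqY i (parSymY i) D U (cutMulY h Ψ)))) z a b‖ ^ 2 :=
        Finset.single_le_sum (f := fun μ' => ∑ ν' : Fin (d + 1), ∑ a, ∑ b, ‖cdS i U μ' (cdS i U ν' (cutMulY h (GsqY i (parSymY i) D U (cutMulY h Ψ)))) z a b‖ ^ 2)
          (fun μ' _ => Finset.sum_nonneg fun ν' _ => hnn z μ' ν') (Finset.mem_univ μ)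

end Second

end Literature.MathematicalPhysics.QuantumFieldTheory.Balaban1983to89.B9Thm31SiteGsqSecondDecayReg335Y

end
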